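import Summits.BirchSwinnertonDyer.BirchSwinnertonDyer.Theorems.ErratumRoadFiveEulerHalfGenusLineTwinsGlue
import Summits.BirchSwinnertonDyer.BirchSwinnertonDyer.Theorems.Rank1ResidualJetKolyvaginLocalTermClosed
import Summits.BirchSwinnertonDyer.Rank1Residual.JET.RingClassTransverseLagrangian
import Summits.BirchSwinnertonDyer.BirchSwinnertonDyer.Theorems.ErratumRoadFiveEulerHalfPOnlyMultPotMultTwinAtFiveGenusKolyvaginPointsRC
import HarnessLib

/-!
# The genus line on `EulerHalfPOnlyMultPotMultTwinAtFive` (23444) — road K's two local PRINT-TO-TYPE schemas DISCHARGED: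
# (i) `JetchevLozengeIndexSchema` is a THEOREM as typed; (ii) `HowardTransverseSelfDualSchema` holds at `d_K < −4`, `k ≥ 1`
# (its typed closure over-claims); the glue (b2b) ⟸ (b2b-κ) and the §2 assembly of the line become SCHEMA-FREE

Seat `bsd-stepL-defn-ty1` g40 (literature-prover typer; `--supports stmt-BirchSwinnertonDyer-23444`, helper).  THEOREMS ONLY:
no definition, no named fact, no `sorry`.  Serves pen `bsd-stepL-plan` g46's 2026-08-29 15:27:45Z ask «PRINT LOCATORS for the two
SCHEMA stubs of genus v2.0».  TREE SEARCH FIRST: both printed lemmas are ALREADY kernel theorems of cell `bsd-jet` (road K), so no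
Literature port is needed —
* [J] Lemma 5.2 (i)–(ii) (the `±`-parts of the Kummer condition at an inert Kolyvagin place have index `p^k`) =
  `JET.GlobalDuality.relIndex_kummer_ker_conjActPlace_eq_pow` (`Theorems/Rank1ResidualJetKolyvaginLocalTerm`, seat `bsd-jet-pv` g6),
  closed over the Poitou–Tate fact by `JET.kolyvaginLocalTerm_of_poitouTate` (`…KolyvaginLocalTermClosed`), and that fact is the
  theorem `InputsPoitouTateSelmer.poitouTate_selmerStructure_duality_conj_holds`;
* Howard 2004 Prop. 2.1.9 (ii) = Mazur–Rubin Prop. 1.3.2 (ii) for `L = K[ℓ]_λ` (the transverse condition is LAGRANGIAN) =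
  `JET.RingClassTransverse.dualTransported_eq_of_localTransverseFamily` (`Rank1Residual/JET/RingClassTransverseLagrangian`, seat
  `bsd-jet-ty` g7), under `d_K < −4` and `1 ≤ k`.

## What
* §1 **`jetchevLozengeIndexSchema_holds : JetchevLozengeIndexSchema`** — schema (i) AS TYPED (`Theorems/…GenusTwinsDefs` l.329,
  = the binder `hloc` of road K's `JET.jetchevDivisibilityCarrierMult_of_localFacts₂`) is a theorem; the registered stub
  `stub_jetchevLozengeIndexSchema` of `Cruxes/EulerHalfPOnlyMultPotMultTwinAtFive/Lines/genus.lean` v2.0 is this term.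
* §2 **`howardTransverseSelfDual_of_discr_lt_neg_four`** — schema (ii)'s body with the two hypotheses the printed proof uses made
  explicit: `NumberField.discr K < −4` (so `𝒪_K^× = {±1}` and `Gal(K[ℓ]/K[1])` is cyclic of order `ℓ + 1`, tree
  `card_ringClassGalOver_eq_succ`) and `1 ≤ k`.  REMARK (no Lean content): the CLOSED schema `HowardTransverseSelfDualSchema`
  (TwinsDefs l.346) quantifies over ALL imaginary quadratic `K`, all odd `p` and all `k`, and so OVER-CLAIMS — at `K = ℚ(√−3)`,
  `p = 3`, `k = ord₃(ℓ + 1)` the completion `K[ℓ]_{w'}/K_λ` has degree `(ℓ + 1)/3`, whose `3`-part is `3^{k−1}`, so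
  `H¹_tr = ker(H¹(K_λ, W[3^k]) → H¹(K[ℓ]_{w'}, W[3^k])) ≅ (ℤ/3^{k−1})²` is NOT its own annihilator in `H¹(K_λ, W[3^k]) ≅ (ℤ/3^k)⁴`
  (instance: `W = 11a1`, `ℓ = 29`: `29 ≡ 2 (mod 3)` inert, `29 ∤ 33`, `a₂₉ = 0`, `M(29) = ord₃ gcd(30, 0) = 1 = k`,
  `[K[29] : K] = 29·(1 + 1/29)/3 = 10` prime to `3`, so `H¹_tr = 0` while its dual transport is all of `H¹(K_λ, W[3]) ≠ 0`).
  Hence `stub_howardTransverseSelfDualSchema` cannot be closed as typed; the genus consumer needs only the `d_K < −4`, `k ≥ 1`,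
  `p ≥ 5` instances, all in scope there (below).
* §3 **`genusJetchevThm63_of_classDataSupply₀ (hκ : GenusClassDataSupply) : GenusJetchevThm63`** — the landed glue
  `genusJetchevThm63_of_classDataSupply` (TwinsGlue §1i) with its two schema binders DISCHARGED in place: `hloc` by §1's source and
  `h𝒯sd` by `dualTransported_eq_of_localTransverseFamily` at the genus frame, where `d_K = d₁d₂ ≤ −9 < −4`
  (`GenusKolyvaginRC.discr_lt_neg_four_of_genus` on `S.hd₁`, `S.hd₂`, `S.hd`) and `1 ≤ k` are in scope.  Proof body otherwise
  VERBATIM the landed one.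
* §4 **`EulerHalfPOnlyMultPotMultTwinAtFive_of_printedFacts_of_classData₀`** — TwinsGlue §2 without the two schema binders: the crux
  BY NAME from the eight ER5 items + the three printed Heegner-point facts + (b1) + (b2a) + (b2b-κ).  With it the pen may re-cut
  `Lines/genus.lean` to THREE stubs (`stub_genusClassDataSupply`, `stub_genusJetchev53`, `stub_genusMcCallum52`).

HONEST FRAMING: conditional theorems only — every binder displayed; the three research stubs, the crux 23444, its parent 19715 and
every ER5 item stay OPEN; no summit statement is proved; BSD is proved for no curve.
References (locators only; no cited FACT is declared): [cite: Jetchev2008, §3.1.2 (p. 814), §3.2 (2)–(3) (p. 815), Prop. 4.2,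
Lemma 5.2 (i)–(ii) (p. 822), Thm. 5.2 (p. 821)] [cite: Howard2004HeegnerKolyvagin, Prop. 2.1.9 (ii), §2.2]
[cite: MazurRubin2004, Def. 1.1.6, Prop. 1.3.2 (ii)] [cite: MilneADT2006, Ch. I, Cor. 2.3, Thm. 2.8] [cite: GrossLMS1991, §3 (3.3)]
[cite: Cox2013, Thm. 7.24 (class number of an order)].  Axioms: `propext`, `Classical.choice`, `Quot.sound`.
-/

set_option autoImplicit false
-- D-0017: single-problem summit, so `Summit.BirchSwinnertonDyer.BirchSwinnertonDyer.…` repeats a namespace BY DESIGN.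
set_option linter.dupNamespace false

noncomputable section

namespace Summit.BirchSwinnertonDyer.BirchSwinnertonDyer.Theorems.GenusLine

open scoped Classical

open NumberField IsDedekindDomain Field Rat.HeightOneSpectrum
open WeierstrassCurve Literature.NumberTheory.EllipticCurves
  Literature.NumberTheory.EllipticCurves.ModularForms
  Literature.NumberTheory.EllipticCurves.CaiShuTian2014
  Literature.NumberTheory.EllipticCurves.Rank1Residual
  Literature.NumberTheory.EllipticCurves.Rank1Residual.Typed
  Literature.NumberTheory.GaloisRepresentations
open Summit.BirchSwinnertonDyer.Rank1Residual
open Summit.BirchSwinnertonDyer.BirchSwinnertonDyer.Theorems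
  Summit.BirchSwinnertonDyer.BirchSwinnertonDyer.Theorems.GenusGrossZagier
  Summit.BirchSwinnertonDyer.BirchSwinnertonDyer.Theorems.RamifiedTwinGenusHeegner
  Summit.BirchSwinnertonDyer.BirchSwinnertonDyer.Theorems.RamifiedTwinRamTransport

section Schemas

open Literature.NumberTheory.EllipticCurves.Jetchev2008 Literature.NumberTheory.GaloisCohomology
  Literature.NumberTheory.GaloisRepresentations.DiscreteGaloisModule
  Summit.BirchSwinnertonDyer.Rank1Residual.JET.SelmerVocabulary Literature.NumberTheory.Automorphic

/-! ### §1 Schema (i) — Jetchev's lozenge index at a Kolyvagin place — is a THEOREM as typed -/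

/-- **Schema (i) `JetchevLozengeIndexSchema` HOLDS** ([J] Lemma 5.2 (i)–(ii): for `K` imaginary quadratic, `τ ≠ 1`, `p` odd,
`1 ≤ k ≤ M(ℓ)` at a Zhang–Kolyvagin prime `ℓ`, the place `v ∋ ℓ` fixed by `τ` and `s = ±1`, the `s`-eigen-kernel of `τ` on
`H¹(K_v, W[p^k])` meets the Kummer condition with index `p^k`).  The term: road K's closed form
`JET.kolyvaginLocalTerm_of_poitouTate` (cell `bsd-jet`, from `GlobalDuality.relIndex_kummer_ker_conjActPlace_eq_pow`: `Kum_v = H¹_ur`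
at good `v ∤ p`, `H¹_ur ≅ W[p^k]` with `τ` acting through a balanced involution, signed local Tate duality) fed with the PROVED
Poitou–Tate fact `InputsPoitouTateSelmer.poitouTate_selmerStructure_duality_conj_holds`.  This is the registered stub
`stub_jetchevLozengeIndexSchema` of line `genus` v2.0 on 23444.  [cite: Jetchev2008, §3.2 (2)–(3) (p. 815), Prop. 4.2,
Lemma 5.2 (i)–(ii) (p. 822)] [cite: MilneADT2006, Ch. I, Cor. 2.3] -/
theorem jetchevLozengeIndexSchema_holds : JetchevLozengeIndexSchema :=
  fun W _ _ K _ _ hK τ hτ p k _ hp2 hk ℓ hℓ hkℓ v hv hfix s hs ↦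
    JET.kolyvaginLocalTerm_of_poitouTate
      (fun K' _ _ ↦ InputsPoitouTateSelmer.poitouTate_selmerStructure_duality_conj_holds K')
      W K hK τ hτ p k hp2 hk ℓ hℓ hkℓ v hv hfix s hs

/-! ### §2 Schema (ii) — Howard's self-duality of the transverse condition — at `d_K < −4`, `k ≥ 1` -/

/-- **Schema (ii) with the printed proof's hypotheses explicit** (Howard 2004 Prop. 2.1.9 (ii) = Mazur–Rubin Prop. 1.3.2 (ii) for
`T = W[p^k]`, `L = K[ℓ]_λ`): for `K` imaginary quadratic with `d_K < −4`, `p` odd, `1 ≤ k`, a square-free `c` on Zhang–Kolyvagin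
primes with `k ≤ M(ℓ)` for all `ℓ ∣ c`, a Selmer structure `𝒯` on `W[p^k]` which at every finite place is the transverse condition
at the primes of `c` (the `⨅` of road K's `exists_localTransverseFamily`), any alternating non-degenerate Galois-equivariant
`μ_{p^k}`-valued pairing `e` and any perfect local invariants: at every `v ∣ c` the Tate-dual transport of `𝒯` IS `𝒯`.  The term:
`JET.RingClassTransverse.dualTransported_eq_of_localTransverseFamily` (cell `bsd-jet`; `d_K < −4` makes `Gal(K[ℓ]/K[1])` cyclic of
order `ℓ + 1`, `card_ringClassGalOver_eq_succ`, so `#H¹_tr = #W(K_λ)[p^k]` and `H¹_tr` is Lagrangian by the count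
`#Tr^⊥ · #Tr = #H¹ = #W(K_λ)[p^k]²`, Milne I Thm. 2.8).  The CLOSED schema `HowardTransverseSelfDualSchema` omits `d_K < −4` and
`1 ≤ k` and over-claims (module docstring: `K = ℚ(√−3)`, `p = 3`, `k = ord₃(ℓ+1)`); this is the form every consumer uses.
[cite: Howard2004HeegnerKolyvagin, Prop. 2.1.9 (ii)] [cite: MazurRubin2004, Def. 1.1.6, Prop. 1.3.2 (ii)]
[cite: MilneADT2006, Ch. I, Cor. 2.3, Thm. 2.8] -/
theorem howardTransverseSelfDual_of_discr_lt_neg_four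
    (W : WeierstrassCurve ℚ) [W.IsElliptic] [W.IsGloballyMinimal]
    (K : Type) [Field K] [NumberField K] (hK : IsImaginaryQuadratic K) (hD : NumberField.discr K < -4)
    (ι : K →+* ℂ) [∀ j : ℕ, NumberField (ringClassField K ι j)]
    (p k : ℕ) [Fact p.Prime] [NeZero (p ^ k)] [Finite (geomTorsion (W.baseChange K) ((p ^ k : ℕ) : ℤ))]
    (hp2 : p ≠ 2) (hk : 1 ≤ k) (c : ℕ) (hc : Squarefree c)
    (hcK : ∀ ℓ ∈ c.primeFactors,
      Zhang2014.IsKolyvaginPrime (W.conductorNorm ℤ) W K p ℓ ∧ k ≤ Zhang2014.kolyvaginIndex W p ℓ)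
    (𝒯 : SelmerStructure ((W.baseChange K).torsionGaloisModule ((p ^ k : ℕ) : ℤ)))
    (h𝒯 : ∀ v : HeightOneSpectrum (𝓞 K), 𝒯 (Sum.inr v) =
      ⨅ ℓ ∈ c.primeFactors.filter (fun ℓ : ℕ ↦ ((ℓ : ℕ) : 𝓞 K) ∈ v.asIdeal),
        ⨅ (w' : HeightOneSpectrum (𝓞 (ringClassField K ι ℓ))) (_ : w'.asIdeal.LiesOver v.asIdeal),
          letI := (adicCompletionOfLiesOver K (ringClassField K ι ℓ) v w').toAlgebra
          transverseSubgroup (GaloisRep.toLocal v ((W.baseChange K).torsionGaloisModule ((p ^ k : ℕ) : ℤ)))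
            (w'.adicCompletion (ringClassField K ι ℓ)))
    (e : geomTorsion (W.baseChange K) ((p ^ k : ℕ) : ℤ) →
        geomTorsion (W.baseChange K) ((p ^ k : ℕ) : ℤ) → AlgebraicClosure K)
    (hμ : ∀ S T, e S T ^ (p ^ k) = 1)
    (hadd₁ : ∀ S₁ S₂ T, e (S₁ + S₂) T = e S₁ T * e S₂ T)
    (hadd₂ : ∀ S T₁ T₂, e S (T₁ + T₂) = e S T₁ * e S T₂)
    (hgal : ∀ (g : absoluteGaloisGroup K) (S T : geomTorsion (W.baseChange K) ((p ^ k : ℕ) : ℤ)),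
      g • e S T = e (g • S) (g • T))
    (halt : ∀ T, e T T = 1) (hnondeg : ∀ T, (∀ S, e S T = 1) → T = 0)
    (inv : LocalInvariants K (p ^ k)) (hperf : inv.IsPerfect)
    (v : HeightOneSpectrum (𝓞 K)) (hvc : v ∈ placesDividing K c) :
    inv.dualTransported 𝒯 (weilDualIntertwining (W.baseChange K) (p ^ k) e hμ hadd₁ hadd₂ hgal)
      (Sum.inr v) = 𝒯 (Sum.inr v) :=
  JET.RingClassTransverse.dualTransported_eq_of_localTransverseFamily W K hK hD ι p hp2 k hk c hc
    (fun ℓ hℓ ↦ (hcK ℓ hℓ).1) (fun ℓ hℓ ↦ (hcK ℓ hℓ).2) 𝒯 h𝒯 e hμ hadd₁ hadd₂ hgal halt hnondeg inv hperf v hvc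

/-! ### §3 (b2b) `GenusJetchevThm63` ⟸ (b2b-κ) `GenusClassDataSupply`, SCHEMA-FREE -/

/-- **(b2b) ⟸ (b2b-κ), SCHEMA-FREE.**  `GenusJetchevThm63` from `GenusClassDataSupply` ALONE: the landed
`genusJetchevThm63_of_classDataSupply` (TwinsGlue §1i; ONE application of
`GenusKolyvagin.ClassData.tamagawaExponent_le_mInfty_of_classData_localFacts` at the split carrier place `v₀ ∣ p`) with its two
print-to-type binders discharged IN PLACE — `hloc` by `JET.GlobalDuality.relIndex_kummer_ker_conjActPlace_eq_pow` (Poitou–Tate fact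
proved) and `h𝒯sd` by §2 (`JET.RingClassTransverse.dualTransported_eq_of_localTransverseFamily`) at the genus frame, where
`d_K = d₁·d₂ ≤ −9 < −4` (`GenusKolyvaginRC.discr_lt_neg_four_of_genus`) and `1 ≤ k`; the rest of the proof is the landed body
verbatim.  Conditional on `hκ`; no summit statement is proved.  [cite: Jetchev2008, Thm. 5.2 (p. 821) and proof (pp. 821–823),
Lemma 5.2, Prop. 4.7, Prop. 4.9] [cite: Howard2004HeegnerKolyvagin, Prop. 2.1.9 (ii)] -/
theorem genusJetchevThm63_of_classDataSupply₀ (hκ : GenusClassDataSupply) : GenusJetchevThm63 := by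
  intro W _ _ A _ _ p q _ _ K _ _ S hprof hidx hsha hPinf
  haveI := S.ell
  haveI := S.min
  haveI := S.nz
  haveI := S.nf
  intro _ τ hτ mdiv m hmdiv hm mInf hmInf hMin k c hk hcore hmc hkM htk hik
  have hp : p.Prime := Fact.out
  have hp5 : 5 ≤ p := hprof.five_le
  have hp2 : p ≠ 2 := by omega
  have hK : IsImaginaryQuadratic K := hprof.quad
  have hD : NumberField.discr K < -4 := GenusKolyvaginRC.discr_lt_neg_four_of_genus hK S.hd₁ S.hd₂ S.hd
  haveI : NeZero (W.conductorNorm ℤ) := ⟨(WeierstrassCurve.conductorNorm_pos_holds _).ne'⟩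
  -- trivial case `t = 0`
  by_cases ht0 : padicValNat p W.tamagawaProduct = 0
  · rw [ht0]; exact Nat.zero_le _
  -- the place of `ℚ` at `p` is the UNIQUE split multiplicative place (`only`, `splitp`): `t = ord_p c_p(W)`
  have hbridge : ∀ (v : HeightOneSpectrum (𝓞 ℚ)) (r : ℕ) [Fact r.Prime], (primesEquiv v : ℕ) = r →
      W.HasSplitMultiplicativeReductionAtPrime r → W.HasSplitMultiplicativeReductionAt v := by
    intro v r _ hv h
    subst hv
    exact (WeierstrassCurve.hasSplitMultiplicativeReductionAtPrime_iff_hasSplitMultiplicativeReductionAt W v).mp h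
  set vℚ : HeightOneSpectrum (𝓞 ℚ) := (primesEquiv (R := 𝓞 ℚ)).symm ⟨p, hp⟩ with hvℚ_def
  have hvℚ : (primesEquiv vℚ : ℕ) = p := by rw [hvℚ_def, Equiv.apply_symm_apply]
  have hsℚ : W.HasSplitMultiplicativeReductionAt vℚ := hbridge vℚ p hvℚ hprof.splitp
  have huniq : ∀ v, W.HasSplitMultiplicativeReductionAt v → v = vℚ := by
    intro v hv
    haveI : Fact (primesEquiv v : ℕ).Prime := ⟨(primesEquiv v).2⟩
    have hmv : W.HasMultiplicativeReductionAtPrime (primesEquiv v : ℕ) :=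
      (WeierstrassCurve.hasMultiplicativeReductionAtPrime_primesEquiv_iff_holds W v (primesEquiv v : ℕ) rfl).mpr
        hv.hasMultiplicativeReductionAt
    have hvp : (primesEquiv v : ℕ) = p := hprof.only _ hmv
    apply (primesEquiv (R := 𝓞 ℚ)).injective
    rw [hvℚ_def, Equiv.apply_symm_apply]
    exact Subtype.ext hvp
  have ht : padicValNat p W.tamagawaProduct = padicValNat p ((W.baseChange ℚ_[p]).localTamagawaNumber ℤ_[p]) := by
    rw [← CornerLocal.padicValNat_tamagawaNumberAt_eq_of_unique_split W p hp5 hsℚ huniq,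
      WeierstrassCurve.tamagawaNumberAt_def, WeierstrassCurve.localTamagawaNumber_padic_eq_holds W vℚ p hvℚ]
  -- the split carrier place `v₀ ∣ p` of `K` (`sp` at `p ∣ N`, `p ≠ q`) and the transport of the row data
  have hmult : W.HasMultiplicativeReductionAtPrime p := hprof.splitp.hasMultiplicativeReductionAtPrime
  have hpN : p ∣ W.conductorNorm ℤ :=
    (W.dvd_conductorNorm_iff_not_hasGoodReductionAtPrime p).mpr
      (WeierstrassCurve.HasMultiplicativeReduction.not_hasGoodReduction (R := ℤ_[p]) hmult)
  obtain ⟨v₀, hv₀, hv₀N, hpv₀⟩ := ShimuraWalk.exists_split_place_of_ncard_eq_two K hK τ hτ p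
    (hprof.sp p hp hpN (fun h ↦ hprof.q_ne h.symm)) hpN
  obtain ⟨hminK, hminP, hcEq, hc0, hcyc⟩ := JET.carrierRowData_of_split W K p hK τ v₀ hv₀ hpv₀
  haveI := hminK
  haveI := hminP
  have hdvd : p ∣ (W.baseChange ℚ_[p]).localTamagawaNumber ℤ_[p] := by
    have h1 : 1 ≤ padicValNat p ((W.baseChange ℚ_[p]).localTamagawaNumber ℤ_[p]) := by
      rw [← ht]; exact Nat.one_le_iff_ne_zero.mpr ht0
    exact dvd_of_one_le_padicValNat h1
  haveI := hcyc (JET.kodairaNeron_isAddCyclic_forall W p p hp2 hdvd)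
  -- `τ² = 1`
  haveI : Algebra.IsQuadraticExtension ℚ K := ⟨hK.1⟩
  have hτ2 : τ * τ = 1 := by
    have hcard : Nat.card (K ≃ₐ[ℚ] K) = 2 := by rw [IsGalois.card_aut_eq_finrank, hK.1]
    obtain ⟨y, -, hyu⟩ := (Nat.card_eq_two_iff' (1 : K ≃ₐ[ℚ] K)).mp hcard
    have h1 : τ = y := hyu τ hτ
    have h2 : τ⁻¹ = y := hyu τ⁻¹ (inv_ne_one.mpr hτ)
    rw [mul_eq_one_iff_eq_inv]
    exact h1.trans h2.symm
  -- level `p^k`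
  haveI : NeZero (p ^ k) := ⟨pow_ne_zero k hp.ne_zero⟩
  haveI : Finite (geomTorsion (W.baseChange K) ((p ^ k : ℕ) : ℤ)) :=
    finite_geomTorsion_of_neZero (W.baseChange K) (p ^ k)
  have hn : ((p ^ k : ℕ) : ℤ) ≠ 0 := by exact_mod_cast pow_ne_zero k hp.ne_zero
  -- the frame inputs of the class-data theorem: `¬CM`, the surjective tower, Poitou–Tate
  have hcm : ¬ W.HasCM := fun h ↦ W.not_hasSurjectiveModNGaloisRep_of_hasCM h hp hp2 hprof.surj
  have htower : ∀ n : ℕ, W.HasSurjectiveModNGaloisRep (p ^ n : ℕ) :=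
    W.forall_hasSurjectiveModNGaloisRep_pow_of_multiplicative_of_surj p hp2 hmult hprof.surj
  have hPT : poitouTate_selmerStructure_duality_conj K :=
    InputsPoitouTateSelmer.poitouTate_selmerStructure_duality_conj_holds K
  -- Kolyvagin data of the core vertex
  have hkc : (k : ℕ∞) ≤ Zhang2014.levelIndex W p c.1 := le_trans le_self_add hkM
  have hcK : ∀ ℓ ∈ c.1.primeFactors, Zhang2014.IsKolyvaginPrime (W.conductorNorm ℤ) W K p ℓ ∧
      k ≤ Zhang2014.kolyvaginIndex W p ℓ := fun ℓ hℓ ↦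
    ⟨c.2.2 ℓ hℓ, Zhang2014.natCast_le_levelIndex_iff.mp hkc ℓ hℓ⟩
  -- the exponent at `v₀` is `t`
  have hfac : (((W.baseChange K).baseChange (v₀.adicCompletion K)).localTamagawaNumber
      (v₀.adicCompletionIntegers K)).factorization p = padicValNat p W.tamagawaProduct := by
    rw [hcEq, Nat.factorization_def _ hp, ht]
  -- `p` lies in both carrier places
  have hpτv₀ : ((p : ℕ) : 𝓞 K) ∈ (τ • v₀).asIdeal := by
    have := (HeightOneSpectrum.smul_mem_smul_asIdeal_iff τ v₀ ((p : ℕ) : 𝓞 K)).mpr hpv₀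
    have hτp : τ • ((p : ℕ) : 𝓞 K) = (p : 𝓞 K) := by
      rw [← MulSemiringAction.toRingHom_apply, map_natCast]
    rwa [hτp] at this
  -- the class data of the genus family at this core vertex
  obtain ⟨ε, hε, κ, κℓ, hκsel, hκsign, hκ0, hordκ, hκℓsign, hκℓkum, h49str, h49tr, h47⟩ :=
    hκ W A p q K S hprof hidx hsha hPinf τ hτ mdiv m hmdiv hm mInf hmInf hMin k c hk hcore hmc hkM hik hn
  rw [← hfac]
  exact GenusKolyvagin.ClassData.tamagawaExponent_le_mInfty_of_classData_localFacts W hcm K hK hPT p hp2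
    htower S.ιc τ hτ hτ2 ε hε k hn c.1 c.2.1 hcK hk hcore mInf hik v₀ hv₀ hv₀N hc0 (by rw [hfac]; exact htk)
    (howardTransverseSelfDual_of_discr_lt_neg_four W K hK hD S.ιc p k hp2 hk c.1 c.2.1 hcK)
    (fun ℓ h1 h2 _ ↦ JET.GlobalDuality.relIndex_kummer_ker_conjActPlace_eq_pow W K hK hPT hp2 hτ hτ2 hk ℓ h1 h2)
    κ hκsel hκsign hκ0 hordκ κℓ hκℓsign hκℓkum
    (fun ℓ h1 h2 h3 q' hq' ↦ by
      rcases Finset.mem_insert.mp hq' with rfl | hq'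
      · exact h49str ℓ h1 h2 h3 _ hpv₀
      · rw [Finset.mem_singleton] at hq'
        subst hq'
        exact h49str ℓ h1 h2 h3 _ hpτv₀)
    h49tr h47

/-! ### §4 The §2 assembly of the line, SCHEMA-FREE -/

/-- **THE POST-ASIDE SHAPE OF (b2b), SCHEMA-FREE** — TwinsGlue §2 `EulerHalfPOnlyMultPotMultTwinAtFive_of_printedFacts_of_classData`
without its two schema binders: the eight ER5 items + the three printed Heegner-point facts + (b1) `GenusMcCallum52` + (b2a)
`GenusJetchev53` + (b2b-κ) `GenusClassDataSupply` BY NAME → the crux BY NAME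
(`EulerHalfPOnlyMultPotMultTwinAtFive_of_printedFacts_of_twins ∘ genusJetchevThm63_of_classDataSupply₀`).  With it the skeleton of
line `genus` on 23444 needs THREE stubs, all research-grade.  Conditional on the displayed binders; BSD is proved for no curve.
[cite: Jetchev2008, Thm. 1.4, Prop. 5.3, Thm. 5.2] [cite: McCallumLMS1991, §5 Prop. 5.2] [cite: GrossLMS1991, §§3–6] -/
theorem EulerHalfPOnlyMultPotMultTwinAtFive_of_printedFacts_of_classData₀
    (hSk : Summit.BirchSwinnertonDyer.BirchSwinnertonDyer.Theses.ErratumRoadFive.SkinnerRankZeroPPart)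
    (hGZK : Summit.BirchSwinnertonDyer.BirchSwinnertonDyer.Theses.ErratumRoadFive.RankEqAnalyticRankLeOne)
    (hmod : Summit.BirchSwinnertonDyer.BirchSwinnertonDyer.Theses.ErratumRoadFive.EntireLFunctionRat)
    (hnf : Summit.BirchSwinnertonDyer.BirchSwinnertonDyer.Theses.ErratumRoadFive.NewformOfEllipticCurve)
    (hMaz : Summit.BirchSwinnertonDyer.BirchSwinnertonDyer.Theses.ErratumRoadFive.MazurManinConstantOddPrimes)
    (hGZ73 : Summit.BirchSwinnertonDyer.BirchSwinnertonDyer.Theses.ErratumRoadFive.GrossZagierRationalPointI73)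
    (hHL : Summit.BirchSwinnertonDyer.BirchSwinnertonDyer.Theses.ErratumRoadFive.HoffsteinLuoNonvanishingTwist)
    (hCST : Summit.BirchSwinnertonDyer.BirchSwinnertonDyer.Theses.ErratumRoadFive.CaiShuTianGrossZagierRingClassChar)
    (hG1 : ∀ (N : ℕ) [NeZero N] (W : WeierstrassCurve ℚ) (K : Type) [Field K] [NumberField K],
      phi_heegnerPointOfConductor_mem_range_map_ringClassField_birch N W K)
    (hNek : Nekovar2007.cmPoint_frobeniusCongruence)
    (hP53 : ∀ (N : ℕ) [NeZero N] (W : WeierstrassCurve ℚ) (K : Type) [Field K] [NumberField K],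
      GrossLMS1991.prop53_conj_pinned_birch N W K)
    (h52 : GenusMcCallum52) (h53 : GenusJetchev53) (hκ : GenusClassDataSupply) :
    Summit.BirchSwinnertonDyer.BirchSwinnertonDyer.Theses.ErratumRoadFive.EulerHalfPOnlyMultPotMultTwinAtFive :=
  EulerHalfPOnlyMultPotMultTwinAtFive_of_printedFacts_of_twins hSk hGZK hmod hnf hMaz hGZ73 hHL hCST hG1 hNek hP53 h52 h53
    (genusJetchevThm63_of_classDataSupply₀ hκ)

end Schemas

end Summit.BirchSwinnertonDyer.BirchSwinnertonDyer.Theorems.GenusLine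

end
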